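import Summits.CriticalPhenomena.PercolationContinuityZ3.Theorems.PercNearOneGluingNoHeavyPcintBondCertZ3K6Defs
import HarnessLib

/-!
# PCINT lane, kernel check 2/8 of the B3r window certificate (`d = 3`, memory 6, `p = 0.2176`): codes `972 ≤ n < 1944`

Cell `prim-pcint`, seat `prim-pcint-2`. The Collatz–Wielandt rows `10^5 · rowB ≤ 99995 · 2·10^72 · v` for the windows with
base-6 code in `[972, 1944)`, by `decide +kernel` (natural-number arithmetic only; four chunks of 243 codes — larger
chunks exceed the kernel's recursion budget for these rows — hence `maxHeartbeats 0`). Does NOT build on p205010.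
-/

namespace Summit.CriticalPhenomena.PercolationContinuityZ3.Theorems.Pcint.Z3B6

set_option maxHeartbeats 0 in
/-- Rows `972 ≤ n < 1215` of the certificate hold. [folklore] -/
theorem checkRangeB_2a : checkRangeB 972 1215 = true := by decide +kernel

set_option maxHeartbeats 0 in
/-- Rows `1215 ≤ n < 1458` of the certificate hold. [folklore] -/
theorem checkRangeB_2b : checkRangeB 1215 1458 = true := by decide +kernel

set_option maxHeartbeats 0 in
/-- Rows `1458 ≤ n < 1701` of the certificate hold. [folklore] -/
theorem checkRangeB_2c : checkRangeB 1458 1701 = true := by decide +kernel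

set_option maxHeartbeats 0 in
/-- Rows `1701 ≤ n < 1944` of the certificate hold. [folklore] -/
theorem checkRangeB_2d : checkRangeB 1701 1944 = true := by decide +kernel

/-- Rows `972 ≤ n < 1944` of the certificate hold. [folklore] -/
theorem checkRangeB_2 : checkRangeB 972 1944 = true :=
  checkRangeB_of_split (checkRangeB_of_split checkRangeB_2a checkRangeB_2b) (checkRangeB_of_split checkRangeB_2c checkRangeB_2d)

end Summit.CriticalPhenomena.PercolationContinuityZ3.Theorems.Pcint.Z3B6
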